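import Literature.Geometry.Lorentzian.SchoenYauStepThreeEnd
import Literature.Geometry.Lorentzian.StabilityOfMinimizersFlow
import HarnessLib

/-!
# Schoen–Yau 1979, Step 3 for an area-minimising surface: (2.13) discharged

`SchoenYauStepThreeEnd.lean` proves Schoen–Yau's (2.16)–(2.18) (Comm. Math. Phys. 65 (1979), §2,
Step 3, pp. 52–55) for a proper minimal immersion of a surface into one-ended asymptotically
Schwarzschildean data with `R ≥ 0`, under two hypotheses on the surface taken from Step 2: the
quadratic area growth (2.9) and the stability inequality (2.13). With
`StabilityOfMinimizersFlow.lean` the second hypothesis is now a theorem for embedded surfaces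
which minimise area under compactly supported deformations — which is how the surface `S` of
Step 2 is obtained ("a complete area minimizing surface", p. 49) and how (2.13) is justified in
print ("By stability", p. 53):

* `SchoenYau.stability_of_isAreaMinimizing` — for a smoothly embedded minimal surface
  `f : S → X` with smooth unit normal, area-minimising on every compact subset of `S`
  (`SurfaceVariation.IsAreaMinimizingOn`), the stability inequality
  `∫ (Ric(ν,ν) + ‖A‖²) u² ≤ ∫ ‖∇u‖²` holds for every smooth compactly supported `u` — exactly the
  hypothesis `hstab` of `curvature_integrals_of_stable_minimal_end`;
* `SchoenYau.curvature_integrals_of_minimizing_minimal_end` — **(2.16)–(2.18) for a proper,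
  embedded, area-minimising minimal surface with quadratic area growth** in the end of the
  positive-mass data: `‖A‖², K, R∘f ∈ L¹`, `½ ∫ (R + ‖A‖²) ≤ ∫ K`, and positivity of the left side
  when `{R∘f > 0}` has positive area.

What remains of Schoen–Yau's Theorem 1 after this file: Step 2 (existence of such a surface by
geometric measure theory, with (2.9)), and the Claim `∫_S K ≤ 0` (pp. 55–63). Everything here is
proved; no definitions, no named facts.

## References

* R. Schoen, S.-T. Yau, *On the proof of the positive mass conjecture in general relativity*,
  Comm. Math. Phys. 65 (1979) 45–76, §2, Step 2 (p. 49), Step 3 (pp. 52–55), (2.9), (2.13),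
  (2.16)–(2.18). [SchoenYauPMT1979]
-/

noncomputable section

open Bundle Set Filter Function Manifold MeasureTheory Module
open scoped Manifold ContDiff Topology

namespace Literature.Geometry.Lorentzian

namespace SchoenYau

open PseudoRiemannianMetric

variable {X : Type} [TopologicalSpace X] [ChartedSpace E3 X] [IsManifold (𝓡 3) ∞ X]
  [T2Space X] [SecondCountableTopology X]
  (D : InitialDataSet (𝓡 3) X) [D.metric.HasLeviCivita]
  {S : Type} [TopologicalSpace S] [ChartedSpace (EuclideanSpace ℝ (Fin 2)) S]
  [IsManifold (𝓡 2) ∞ S] [T3Space S] [SecondCountableTopology S] [MeasurableSpace S]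
  [BorelSpace S]

omit [T3Space S] [SecondCountableTopology S] [MeasurableSpace S] [BorelSpace S] in
/-- `‖∇u‖²` vanishes off the support of `u`. [folklore] -/
theorem gradSq_eq_zero_of_notMem_tsupport (g : PseudoRiemannianMetric (𝓡 2) ∞
      (EuclideanSpace ℝ (Fin 2)) (TangentSpace (𝓡 2) : S → Type _))
    {u : S → ℝ} {y : S} (hy : y ∉ tsupport u) : g.gradSq u y = 0 := by
  have h0 : mvfderiv (𝓡 2) u y = 0 :=
    mvfderiv_eq_zero_of_eventuallyEq_zero (notMem_tsupport_iff_eventuallyEq.1 hy)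
  simp [gradSq, h0, PseudoRiemannianMetric.innerDual]

/-- **Area-minimising embedded minimal surfaces are stable, in the form of the hypothesis (2.13)
of Step 3.** For data `D` on the `3`-manifold `X` and a smooth embedding `f : S → X` of a surface
which is a minimal immersion with smooth unit normal `ν`, area-minimising on every compact subset
of `S` under compactly supported smooth deformations (`SurfaceVariation.IsAreaMinimizingOn`), the
stability inequality `∫ (Ric(ν,ν) + ‖A‖²) u² dμ ≤ ∫ ‖∇u‖² dμ` holds for every smooth `u` of compact
support (Schoen–Yau 1979, p. 53, (2.13): "By stability we have for each smooth function `f` with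
compact support on `S`"; `SurfaceVariation.stability_of_isAreaMinimizingOn` on a compact
neighbourhood of `supp u`). [cite: SchoenYauPMT1979, §2 (2.13), p. 53] -/
theorem stability_of_isAreaMinimizing {f : S → X} (hpb : contMDiff_pullbackBilin (𝓡 3) X (𝓡 2) S ∞)
    (hemb : IsSmoothEmbedding (𝓡 2) (𝓡 3) ∞ f) (hfi : D.metric.IsSpacelikeImmersion (𝓡 2) f)
    {ν : NormalField (𝓡 3) f}
    (hν : ContMDiff (𝓡 2) (𝓡 3).tangent ∞
      (fun x ↦ (TotalSpace.mk' E3 (f x) (ν x) : TangentBundle (𝓡 3) X)))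
    (hun : D.metric.IsUnitNormal (𝓡 2) f ν 1) (hmin : D.metric.IsMaximalSlice f hpb hfi ν)
    (harea : ∀ K : Set S, IsCompact K → SurfaceVariation.IsAreaMinimizingOn (h := D.h) hpb f K)
    (u : S → ℝ) (hu : ContMDiff (𝓡 2) 𝓘(ℝ, ℝ) ∞ u) (huc : HasCompactSupport u) :
    ∫ y, (D.metric.ricci (f y) (ν y) (ν y) +
        (D.metric.inducedMetric f hpb hfi).normSq y (D.metric.secondFundamentalForm (𝓡 2) f ν y)) *
        u y ^ 2 ∂(riemannianMeasure (D.metric.inducedRiemannianMetric f hpb hfi)) ≤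
      ∫ y, (D.metric.inducedMetric f hpb hfi).gradSq u y
        ∂(riemannianMeasure (D.metric.inducedRiemannianMetric f hpb hfi)) := by
  haveI : (ofRiemannian D.h).HasLeviCivita := ‹D.metric.HasLeviCivita›
  haveI : LocallyCompactSpace X := Manifold.locallyCompact_of_finiteDimensional (I := 𝓡 3)
  haveI : LocallyCompactSpace S := Manifold.locallyCompact_of_finiteDimensional (I := 𝓡 2)
  obtain ⟨K, hK, hKu⟩ := exists_compact_superset huc.isCompact
  obtain ⟨-, hineq⟩ := SurfaceVariation.stability_of_isAreaMinimizingOn (h := D.h) (hpb := hpb)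
    hemb hfi hν hun hmin hu hK hKu (harea K hK)
  set μ := riemannianMeasure (D.metric.inducedRiemannianMetric f hpb hfi) with hμ
  have hzero₁ : ∀ y, y ∉ K → (D.metric.ricci (f y) (ν y) (ν y) +
      (D.metric.inducedMetric f hpb hfi).normSq y (D.metric.secondFundamentalForm (𝓡 2) f ν y)) *
      u y ^ 2 = 0 := fun y hy ↦ by
    rw [image_eq_zero_of_notMem_tsupport (fun h ↦ hy (interior_subset (hKu h)))]
    ring
  have hzero₂ : ∀ y, y ∉ K → (D.metric.inducedMetric f hpb hfi).gradSq u y = 0 := fun y hy ↦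
    gradSq_eq_zero_of_notMem_tsupport _ (fun h ↦ hy (interior_subset (hKu h)))
  rw [← setIntegral_eq_integral_of_forall_compl_eq_zero hzero₁,
    ← setIntegral_eq_integral_of_forall_compl_eq_zero hzero₂]
  exact hineq

/-- **Schoen–Yau 1979, §2, Step 3, (2.16)–(2.18), for an area-minimising surface.** Let `D` be data
on the `3`-manifold `X` with one end `e`, asymptotically Schwarzschildean of mass `M` to second
order ((1.1)) with `R ≥ 0`, and let `f : S → X` be a smoothly embedded, proper, minimal surface
(unit normal `ν` with smooth lift, `H = 0`, (2.12)) with the quadratic area growth (2.9) which is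
area-minimising on every compact subset of `S` under compactly supported smooth deformations — the
properties of the surface of Step 2 (p. 49). Then `‖A‖², K, R∘f ∈ L¹(S)`,
`½ ∫ (R + ‖A‖²) ≤ ∫ K`, and the left side is positive whenever `{R∘f > 0}` has positive area
((2.16)–(2.18)). By `curvature_integrals_of_stable_minimal_end`, the stability (2.13) being
`stability_of_isAreaMinimizing`. [cite: SchoenYauPMT1979, §2, Step 3, pp. 52–55, (2.13), (2.16)–(2.18)] -/
theorem curvature_integrals_of_minimizing_minimal_end (e : AFEnd X) {M : ℝ}
    (hAS : IsAsymptoticallySchwarzschild e D M 2) (hsole : e.IsSoleEnd)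
    (hR0 : ∀ x : X, 0 ≤ D.metric.scalarCurvature x)
    {f : S → X} (hpb : contMDiff_pullbackBilin (𝓡 3) X (𝓡 2) S ∞)
    (hemb : IsSmoothEmbedding (𝓡 2) (𝓡 3) ∞ f)
    (hfi : D.metric.IsSpacelikeImmersion (𝓡 2) f)
    (hprop : ∀ K : Set X, IsCompact K → IsCompact (f ⁻¹' K))
    {ν : NormalField (𝓡 3) f}
    (hν : ContMDiff (𝓡 2) (𝓡 3).tangent ∞
      (fun x ↦ (TotalSpace.mk' E3 (f x) (ν x) : TangentBundle (𝓡 3) X)))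
    (hun : D.metric.IsUnitNormal (𝓡 2) f ν 1) (hmin : D.metric.IsMaximalSlice f hpb hfi ν)
    (hgrowth : ∃ C : ℝ, ∀ t : ℝ, 1 ≤ t →
      riemannianMeasure (D.metric.inducedRiemannianMetric f hpb hfi) (f ⁻¹' (e.far t)ᶜ) ≤
        ENNReal.ofReal (C * t ^ 2))
    (harea : ∀ K : Set S, IsCompact K → SurfaceVariation.IsAreaMinimizingOn (h := D.h) hpb f K) :
    haveI := (D.metric.inducedMetric f hpb hfi).hasLeviCivita
    Integrable (fun y ↦ D.metric.scalarCurvature (f y))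
        (riemannianMeasure (D.metric.inducedRiemannianMetric f hpb hfi)) ∧
      Integrable (fun y ↦ (D.metric.inducedMetric f hpb hfi).normSq y
          (D.metric.secondFundamentalForm (𝓡 2) f ν y))
        (riemannianMeasure (D.metric.inducedRiemannianMetric f hpb hfi)) ∧
      Integrable (fun y ↦ (D.metric.inducedMetric f hpb hfi).scalarCurvature y / 2)
        (riemannianMeasure (D.metric.inducedRiemannianMetric f hpb hfi)) ∧
      (1 / 2) * ∫ y, (D.metric.scalarCurvature (f y) +
          (D.metric.inducedMetric f hpb hfi).normSq y (D.metric.secondFundamentalForm (𝓡 2) f ν y))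
          ∂(riemannianMeasure (D.metric.inducedRiemannianMetric f hpb hfi)) ≤
        ∫ y, (D.metric.inducedMetric f hpb hfi).scalarCurvature y / 2
          ∂(riemannianMeasure (D.metric.inducedRiemannianMetric f hpb hfi)) ∧
      (riemannianMeasure (D.metric.inducedRiemannianMetric f hpb hfi)
          {y | 0 < D.metric.scalarCurvature (f y)} ≠ 0 →
        0 < (1 / 2) * ∫ y, (D.metric.scalarCurvature (f y) +
          (D.metric.inducedMetric f hpb hfi).normSq y (D.metric.secondFundamentalForm (𝓡 2) f ν y))
          ∂(riemannianMeasure (D.metric.inducedRiemannianMetric f hpb hfi))) :=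
  curvature_integrals_of_stable_minimal_end D e hAS hsole hR0 (by simp) hpb hfi hprop hν hun hmin
    hgrowth (stability_of_isAreaMinimizing D hpb hemb hfi hν hun hmin harea)

end SchoenYau

end Literature.Geometry.Lorentzian

end
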